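/-
Copyright: the b2b-balaban T⁴-continuum CRUX team, row NE7b leaf lineage `t4-ne7b-formalise-leaf-04` (gen 156). Project licence.
-/
import Summits.QuantumFields.BalabanUV.T4Continuum.Spine.NE7b.HardStepBranchDeriv

/-!
# THE HARD STEP'S CHART CONSTANT IS THE REFERENCE SECTION'S NORM, NOT THE FULL INVERSE BOUND:
# `‖σ′(w)‖ ≤ (1 − Nc)⁻¹·‖T⁻¹ ∘ inl‖` and `‖σ′(w) − T⁻¹ ∘ inl‖ ≤ Nc(1 − Nc)⁻¹·‖T⁻¹ ∘ inl‖` on HSCR's chart — the Neumann series taken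
# RELATIVE TO THE REFERENCE SECTION `T⁻¹ ∘ inl` (three lines: `e − e₀ = −T⁻¹(A − T)e`), in place of HSBD's `(N⁻¹ − c)⁻¹ = N(1 − Nc)⁻¹`,
# which carries the full inverse bound `N` (the `m⁻¹`-sized fibre component of `DΦ⁻¹`) that the branch derivative never sees
# (row NE7b, node U5c; the located chart letter (α) of the pricing desk's F686 ∕ F689; [folklore] operator algebra, this lineage's HSBD by name)

Cell `pub-balaban`, sub-cell `t4`, spine estimate NE7b (`T4WeightBudget.RelWeightBound`; the cell's OWN estimate — NOT PRINTED in
[Bałaban 1983–89], NOT PROVED).  Crux-route work under `Spine/NE7b/` by leaf-04 in its own hard-step chart cell (HSCR p380448 ∕ HSBD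
p381370 ∕ HSBDM p381466 ∕ HSAH p381740 ∕ HKAH p383019 are this lineage's); NOTHING of Bałaban's is named or asserted; no
`T4Continuum/Support` leaf typed; no `def`; zero `sorry`.  Imports: this lineage's BUILT `…HardStepBranchDeriv` (HSBD) only (Mathlib through it).

WHY.  HSBD types `σ′(w) = DΦ(σ w)⁻¹ ∘ inl` with the bound `‖σ′(w)‖ ≤ (N⁻¹ − c)⁻¹`, where `N` bounds the FULL inverse `‖T⁻¹ y‖ ≤ N‖y‖`
of the reference linearisation `T ≈ DΦ = (D, L)` and `c` the deviation `‖DΦ(x) − T‖ ≤ c` on the chart.  Downstream (HSTT ∕ HSIS ∕ HSUB ∕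
HSUT) this became the chart constant `K₁ := (N⁻¹ − c)⁻¹ ≥ N`, and the pricing desk located (F686 (α), kernel; F689 (4), by value) that
THIS is the letter which empties the unit box: `N` is AHE's equivalence bound `≥ (1 + x_B)‖M‖ + 1` — it must invert the Hessian on the
fibre (size `m⁻¹` in natural units) — while the branch derivative `σ′ = DΦ⁻¹ ∘ inl` only ever applies the inverse to vectors `(k, 0)`:
by value `‖σ′‖·‖D‖ = 1.06–1.12` along the free flow against `K₁‖D‖ ≥ 5`.  THIS FILE removes the slack at the level of the operator
algebra, with no new hypothesis: writing `A = DΦ(σ w)`, `e = A⁻¹ z`, `e₀ = T⁻¹ z`, one has `T(e − e₀) = −(A − T)e`, so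
`‖e − e₀‖ ≤ Nc‖e‖` and hence **`‖A⁻¹ z‖ ≤ (1 − Nc)⁻¹‖T⁻¹ z‖`** for EVERY `z` — the full-inverse letter `N` enters only through the
small product `Nc` (= `N·M₃·r`, vanishing with the chart radius), and the size of `A⁻¹` in the direction `z = (k, 0)` is that of the
REFERENCE SECTION `T⁻¹(k, 0)`.  On HSCR's chart this gives `‖σ′(w)‖ ≤ (1 − Nc)⁻¹ τ₀` with `τ₀ := ‖T⁻¹ ∘ inl‖` — for `T = DΦ(δ₀)` the
centre's own critical section `σ′(w₀)` (HSBD §4: `D ∘ (T⁻¹ ∘ inl) = 1`, `L ∘ (T⁻¹ ∘ inl) = 0`), whose norm leaf-06's THEC §1c values through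
a TEST section: `τ₀ ≤ ‖S‖ + √(C_S∕m)` — and the companion `‖σ′(w) − σ′-reference‖ ≤ Nc(1 − Nc)⁻¹ τ₀`: along the whole chart the branch
derivative stays within RELATIVE distance `Nc∕(1 − Nc)` of the centre's section (no modulus of `V″` needed, unlike HSBDM's Lipschitz letter).
In HSUB's real letters the chart constant becomes `K₁♯ := (1 − Nc)⁻¹ τ₀ ≤ K₁` and F686's emptiness route (`N ≤ K₁`) does not apply to
`K₁♯` (§3 toy: `N = 10`, `c = 0`, `τ₀ = 1` gives `K₁ = 10`, `K₁♯ = 1`).  What it does NOT repair: the two-scale coercivity ratio `γ` and the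
coercivity transport (F689 (3): ×1.155 at the `L = 2` Gaussian fixed point) — leaf-06's road (THEC ∕ TFC ∕ the invariant-region END).  THE
CONSUMER (the pricing desk's first-refusal word on this file's LOCUS, F698 ∕ F699, zero weight, numbers NOT used here): by value on the `d = 4`,
`L = 2` Gaussian skeleton the reference-section product is `‖σ′‖‖Q‖ = 1.09–1.17` along the flow against the Neumann chart letter's
`K₁‖D‖ > 9 → > 26`, so the repair is large and enters SQUARED wherever a size letter is transported through the chart; but HSUB's non-growth
END `Θ ≤ 1` stays EMPTY on the skeleton even with exact section norms (`x_B` itself grows to its fixed point) — the letters of §2 are meant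
for the REGION ∕ THEC consumers (`B ≤ β·m`-type invariant regions), not for `Θ ≤ 1`; §3's `Θ♯ ≤ Θ` is bookkeeping only.  THE
COERCIVITY-ROUTE TWIN (leaf-03's `…PropagatorPerturbation` (PPT), staged in parallel — by shape, not imported, no statement shared): at a
point where `V″(σ w)` is within `c′` of an `m`-coercive-on-`ker D` form `Q₀` with critical section `T₀` and `c′ < m`, PPT gives
`‖σ′(w)‖ ≤ (m∕(m − c′))‖T₀‖` from criticality alone — no chart, no `N`; THIS file works inside HSCR's chart letters `(T, N, c)` (the same
`Nc < 1` that gives the chart its radius), for ANY slice chart `Φ = (D, L)` (symmetric or not, coercive or not), as a drop-in for HSBD's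
consumers; neither factor implies the other in general.

WHAT IS PROVED ([folklore]; `E`, `G` real normed spaces, `T A : E ≃L[ℝ] G`, `N c : ℝ≥0`):
* §1 SHARP NEUMANN LETTERS (any normed spaces, no completeness): `symm_sub_symm_eq` (`A⁻¹z − T⁻¹z = −T⁻¹((A − T)(A⁻¹z))`),
  `norm_symm_sub_symm_le_mul_norm_symm` (`‖A⁻¹z − T⁻¹z‖ ≤ Nc·‖A⁻¹z‖`), **`norm_symm_le_sharp`** (`Nc < 1 ⟹ ‖A⁻¹z‖ ≤ (1 − Nc)⁻¹‖T⁻¹z‖`),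
  **`norm_symm_sub_symm_le_sharp`** (`‖A⁻¹z − T⁻¹z‖ ≤ Nc(1 − Nc)⁻¹‖T⁻¹z‖`), `sharp_le_crude` (`(1 − Nc)⁻¹‖T⁻¹z‖ ≤ (N⁻¹ − c)⁻¹‖z‖`: never
  worse than HSBD), and the operator forms through any `R : X →L[ℝ] G`: **`opNorm_symm_comp_le_sharp`** (`‖A⁻¹ ∘ R‖ ≤ (1 − Nc)⁻¹‖T⁻¹ ∘ R‖`),
  **`opNorm_symm_comp_sub_le_sharp`** (`‖A⁻¹ ∘ R − T⁻¹ ∘ R‖ ≤ Nc(1 − Nc)⁻¹‖T⁻¹ ∘ R‖`).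
* §2 ON HSCR's CHART, HSBD's LETTERS VERBATIM (`E` complete; `hasFDerivAt_sliceBranch_of_chart` BY NAME): **`norm_fderiv_sliceBranch_le_sharp`**
  (`‖fderiv σ w‖ ≤ (1 − Nc)⁻¹·‖T⁻¹ ∘ inl‖` at every `w ∈ ball w₀ ρ`), **`norm_fderiv_sliceBranch_sub_le_sharp`**
  (`‖fderiv σ w − T⁻¹ ∘ inl‖ ≤ Nc(1 − Nc)⁻¹·‖T⁻¹ ∘ inl‖`), `hasFDerivAt_sliceBranch_sharp` (the `HasFDerivAt` statement with both bounds).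
* §3 THE CHART CONSTANT IN HSUB's REAL LETTERS: `sharpChart_le_crudeChart` (`τ₀ ≤ N`, `Nc < 1`, `N > 0` ⟹ `(1 − Nc)⁻¹τ₀ ≤ (N⁻¹ − c)⁻¹`),
  `theta_sharp_le_theta` (`((1 − Nc)⁻¹τ₀)²d²∕γ ≤ ((N⁻¹ − c)⁻¹)²d²∕γ`), `sharpChart_le_of_testSection` (THEC §1c's shape `τ₀ ≤ s + √(C∕m)` fed
  in: `K₁♯ ≤ (1 − Nc)⁻¹(s + √(C∕m))`), and toys (`example`s): `N = 10, c = 0, τ₀ = 1`: `K₁ = 10`, `K₁♯ = 1 < N` (F686's hypothesis `N ≤ K₁`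
  fails for `K₁♯`); the §1 letters on `ℝ` with `T = A = 1`.

NOT HERE (honest): which `Φ, T, N, c` are Bałaban's and the value of `τ₀` for his averaging operators ((A3) ∕ (A1c), NC-NE7b-α UNRULED;
F689's `P = 1.06–1.12` is the desk's by-value number for the free field, not used); the re-run of HSIS ∕ HSUB ∕ HSUT with `K₁♯` (their
authors' files — this file supplies the letter `hN♯` they would consume); the coercivity-ratio debt `γ` and the transport loss (TFC ∕ THEC
road); anything of Bałaban's.  BY-NAME EFFECT ON THE WALL: NONE.  NE7b NOT PRINTED ∕ NOT PROVED; spine PROVED 0∕9; rung (B)+1 on a FINITE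
torus — NOT infinite volume, NOT the mass gap, NOT Clay.  HONEST DEPENDENCY: continuum YM on T⁴ ⇐ BetaPertH ∧ nine spine estimates (0∕9
proved); BetaPertH ⇐ (D1) ∧ (D4) ∧ CAP+tail; G-an2-4 gates asym, D1 and NE2∕3∕4.
-/

set_option autoImplicit false

noncomputable section

namespace Summit.QuantumFields.BalabanUV.T4Continuum.NE7b.HardStepBranchDerivSharp

open Set Filter Topology Function Metric
open scoped NNReal
open Summit.QuantumFields.BalabanUV.T4Continuum.NE7b.HardStepBranchDeriv

variable {E G : Type*} [NormedAddCommGroup E] [NormedSpace ℝ E] [NormedAddCommGroup G] [NormedSpace ℝ G]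

/-! ## §1. Sharp Neumann letters: the inverse of a `c`-perturbation, relative to the reference inverse -/

/-- **THE RESOLVENT IDENTITY IN ONE DIRECTION**: `A⁻¹z − T⁻¹z = −T⁻¹((A − T)(A⁻¹z))` (apply `T`: `T(A⁻¹z) − z = −(A − T)(A⁻¹z)`
since `A(A⁻¹z) = z`). [folklore] -/
theorem symm_sub_symm_eq (T A : E ≃L[ℝ] G) (z : G) :
    A.symm z - T.symm z = -T.symm (((A : E →L[ℝ] G) - (T : E →L[ℝ] G)) (A.symm z)) := by
  have h : T (A.symm z - T.symm z) = -(((A : E →L[ℝ] G) - (T : E →L[ℝ] G)) (A.symm z)) := by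
    rw [map_sub, T.apply_symm_apply, sub_apply, ContinuousLinearEquiv.coe_coe, ContinuousLinearEquiv.coe_coe,
      A.apply_symm_apply]
    abel
  calc A.symm z - T.symm z = T.symm (T (A.symm z - T.symm z)) := (T.symm_apply_apply _).symm
    _ = -T.symm (((A : E →L[ℝ] G) - (T : E →L[ℝ] G)) (A.symm z)) := by rw [h, map_neg]

/-- `‖A⁻¹z − T⁻¹z‖ ≤ Nc·‖A⁻¹z‖` from `‖T⁻¹y‖ ≤ N‖y‖` and `‖A − T‖ ≤ c`. [folklore] -/
theorem norm_symm_sub_symm_le_mul_norm_symm (T A : E ≃L[ℝ] G) {N c : ℝ≥0} (hN : ∀ y : G, ‖T.symm y‖ ≤ N * ‖y‖)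
    (hA : ‖(A : E →L[ℝ] G) - (T : E →L[ℝ] G)‖ ≤ c) (z : G) :
    ‖A.symm z - T.symm z‖ ≤ N * c * ‖A.symm z‖ := by
  rw [symm_sub_symm_eq T A z, norm_neg]
  calc ‖T.symm (((A : E →L[ℝ] G) - (T : E →L[ℝ] G)) (A.symm z))‖
        ≤ N * ‖(((A : E →L[ℝ] G) - (T : E →L[ℝ] G)) (A.symm z))‖ := hN _
    _ ≤ N * (c * ‖A.symm z‖) := by
        refine mul_le_mul_of_nonneg_left ?_ N.coe_nonneg
        exact (ContinuousLinearMap.le_opNorm _ _).trans (mul_le_mul_of_nonneg_right hA (norm_nonneg _))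
    _ = N * c * ‖A.symm z‖ := by ring

/-- **SHARP NEUMANN LETTER**: `Nc < 1 ⟹ ‖A⁻¹z‖ ≤ (1 − Nc)⁻¹·‖T⁻¹z‖` — the size of the perturbed inverse IN THE DIRECTION `z` is that of
the reference inverse in that direction; the full-inverse bound `N` enters only through `Nc`. [folklore] -/
theorem norm_symm_le_sharp (T A : E ≃L[ℝ] G) {N c : ℝ≥0} (hN : ∀ y : G, ‖T.symm y‖ ≤ N * ‖y‖)
    (hA : ‖(A : E →L[ℝ] G) - (T : E →L[ℝ] G)‖ ≤ c) (hNc : (N : ℝ) * c < 1) (z : G) :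
    ‖A.symm z‖ ≤ (1 - (N : ℝ) * c)⁻¹ * ‖T.symm z‖ := by
  have h1 := norm_symm_sub_symm_le_mul_norm_symm T A hN hA z
  have h2 : ‖A.symm z‖ ≤ ‖T.symm z‖ + ‖A.symm z - T.symm z‖ := by
    have := norm_add_le (T.symm z) (A.symm z - T.symm z)
    rwa [add_sub_cancel] at this
  have hpos : 0 < 1 - (N : ℝ) * c := sub_pos.2 hNc
  rw [← div_eq_inv_mul, le_div_iff₀ hpos]
  nlinarith

/-- **SHARP NEUMANN LETTER FOR THE DIFFERENCE**: `‖A⁻¹z − T⁻¹z‖ ≤ Nc(1 − Nc)⁻¹·‖T⁻¹z‖`. [folklore] -/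
theorem norm_symm_sub_symm_le_sharp (T A : E ≃L[ℝ] G) {N c : ℝ≥0} (hN : ∀ y : G, ‖T.symm y‖ ≤ N * ‖y‖)
    (hA : ‖(A : E →L[ℝ] G) - (T : E →L[ℝ] G)‖ ≤ c) (hNc : (N : ℝ) * c < 1) (z : G) :
    ‖A.symm z - T.symm z‖ ≤ (N : ℝ) * c * (1 - (N : ℝ) * c)⁻¹ * ‖T.symm z‖ := by
  have h1 := norm_symm_sub_symm_le_mul_norm_symm T A hN hA z
  have h2 := norm_symm_le_sharp T A hN hA hNc z
  have hNc0 : 0 ≤ (N : ℝ) * c := by positivity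
  calc ‖A.symm z - T.symm z‖ ≤ N * c * ‖A.symm z‖ := h1
    _ ≤ N * c * ((1 - (N : ℝ) * c)⁻¹ * ‖T.symm z‖) := mul_le_mul_of_nonneg_left h2 hNc0
    _ = (N : ℝ) * c * (1 - (N : ℝ) * c)⁻¹ * ‖T.symm z‖ := by ring

/-- **NEVER WORSE THAN HSBD**: `(1 − Nc)⁻¹‖T⁻¹z‖ ≤ (N⁻¹ − c)⁻¹‖z‖` (since `‖T⁻¹z‖ ≤ N‖z‖` and `N(1 − Nc)⁻¹ = (N⁻¹ − c)⁻¹` for `N > 0`;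
for `N = 0` both sides vanish on the left). [folklore] -/
theorem sharp_le_crude (T : E ≃L[ℝ] G) {N c : ℝ≥0} (hN : ∀ y : G, ‖T.symm y‖ ≤ N * ‖y‖) (hNc : (N : ℝ) * c < 1) (z : G) :
    (1 - (N : ℝ) * c)⁻¹ * ‖T.symm z‖ ≤ ((N : ℝ)⁻¹ - c)⁻¹ * ‖z‖ := by
  have hpos : 0 < 1 - (N : ℝ) * c := sub_pos.2 hNc
  rcases eq_or_ne N 0 with hN0 | hN0
  · -- `N = 0` forces `T⁻¹ z = 0`, hence `z = T (T⁻¹ z) = 0`: both sides vanish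
    have hz : ‖T.symm z‖ ≤ 0 := by simpa [hN0] using hN z
    have hz0 : ‖T.symm z‖ = 0 := le_antisymm hz (norm_nonneg _)
    have hz' : z = 0 := by
      have h0 : T.symm z = 0 := norm_eq_zero.1 hz0
      simpa using congrArg T h0
    rw [hz0, mul_zero]
    simp [hz']
  · have hNpos : (0 : ℝ) < N := by exact_mod_cast pos_iff_ne_zero.2 hN0
    have hkey : (1 - (N : ℝ) * c)⁻¹ * N = ((N : ℝ)⁻¹ - c)⁻¹ := by
      have h1 : (N : ℝ)⁻¹ - c = (1 - (N : ℝ) * c) / N := by field_simp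
      rw [h1, inv_div, div_eq_inv_mul]
    calc (1 - (N : ℝ) * c)⁻¹ * ‖T.symm z‖ ≤ (1 - (N : ℝ) * c)⁻¹ * (N * ‖z‖) :=
          mul_le_mul_of_nonneg_left (hN z) (inv_nonneg.2 hpos.le)
      _ = ((N : ℝ)⁻¹ - c)⁻¹ * ‖z‖ := by rw [← mul_assoc, hkey]

section Operator

variable {X : Type*} [NormedAddCommGroup X] [NormedSpace ℝ X]

/-- **OPERATOR FORM**: for any `R : X →L G` (e.g. `inl`), `‖A⁻¹ ∘ R‖ ≤ (1 − Nc)⁻¹·‖T⁻¹ ∘ R‖`. [folklore] -/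
theorem opNorm_symm_comp_le_sharp (T A : E ≃L[ℝ] G) {N c : ℝ≥0} (hN : ∀ y : G, ‖T.symm y‖ ≤ N * ‖y‖)
    (hA : ‖(A : E →L[ℝ] G) - (T : E →L[ℝ] G)‖ ≤ c) (hNc : (N : ℝ) * c < 1) (R : X →L[ℝ] G) :
    ‖(A.symm : G →L[ℝ] E).comp R‖ ≤ (1 - (N : ℝ) * c)⁻¹ * ‖(T.symm : G →L[ℝ] E).comp R‖ := by
  have hpos : 0 < 1 - (N : ℝ) * c := sub_pos.2 hNc
  refine ContinuousLinearMap.opNorm_le_bound _ (by positivity) fun x => ?_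
  rw [ContinuousLinearMap.comp_apply, ContinuousLinearEquiv.coe_coe]
  calc ‖A.symm (R x)‖ ≤ (1 - (N : ℝ) * c)⁻¹ * ‖T.symm (R x)‖ := norm_symm_le_sharp T A hN hA hNc (R x)
    _ ≤ (1 - (N : ℝ) * c)⁻¹ * (‖(T.symm : G →L[ℝ] E).comp R‖ * ‖x‖) := by
        refine mul_le_mul_of_nonneg_left ?_ (inv_nonneg.2 hpos.le)
        exact ((T.symm : G →L[ℝ] E).comp R).le_opNorm x
    _ = (1 - (N : ℝ) * c)⁻¹ * ‖(T.symm : G →L[ℝ] E).comp R‖ * ‖x‖ := by ring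

/-- **OPERATOR FORM FOR THE DIFFERENCE**: `‖A⁻¹ ∘ R − T⁻¹ ∘ R‖ ≤ Nc(1 − Nc)⁻¹·‖T⁻¹ ∘ R‖`. [folklore] -/
theorem opNorm_symm_comp_sub_le_sharp (T A : E ≃L[ℝ] G) {N c : ℝ≥0} (hN : ∀ y : G, ‖T.symm y‖ ≤ N * ‖y‖)
    (hA : ‖(A : E →L[ℝ] G) - (T : E →L[ℝ] G)‖ ≤ c) (hNc : (N : ℝ) * c < 1) (R : X →L[ℝ] G) :
    ‖(A.symm : G →L[ℝ] E).comp R - (T.symm : G →L[ℝ] E).comp R‖ ≤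
      (N : ℝ) * c * (1 - (N : ℝ) * c)⁻¹ * ‖(T.symm : G →L[ℝ] E).comp R‖ := by
  have hpos : 0 < 1 - (N : ℝ) * c := sub_pos.2 hNc
  refine ContinuousLinearMap.opNorm_le_bound _ (by positivity) fun x => ?_
  rw [sub_apply, ContinuousLinearMap.comp_apply, ContinuousLinearMap.comp_apply,
    ContinuousLinearEquiv.coe_coe, ContinuousLinearEquiv.coe_coe]
  calc ‖A.symm (R x) - T.symm (R x)‖ ≤ (N : ℝ) * c * (1 - (N : ℝ) * c)⁻¹ * ‖T.symm (R x)‖ :=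
        norm_symm_sub_symm_le_sharp T A hN hA hNc (R x)
    _ ≤ (N : ℝ) * c * (1 - (N : ℝ) * c)⁻¹ * (‖(T.symm : G →L[ℝ] E).comp R‖ * ‖x‖) := by
        refine mul_le_mul_of_nonneg_left ?_ (by positivity)
        exact ((T.symm : G →L[ℝ] E).comp R).le_opNorm x
    _ = (N : ℝ) * c * (1 - (N : ℝ) * c)⁻¹ * ‖(T.symm : G →L[ℝ] E).comp R‖ * ‖x‖ := by ring

end Operator

/-! ## §2. On HSCR's chart, in HSBD's letters: the branch derivative is controlled by the reference section -/

section Chart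

variable {F H : Type*} [NormedAddCommGroup F] [NormedSpace ℝ F] [NormedAddCommGroup H] [NormedSpace ℝ H]

/-- `c < N⁻¹` in `ℝ≥0` gives `N·c < 1` in `ℝ`. [folklore] -/
theorem coe_mul_lt_one_of_lt_inv {N c : ℝ≥0} (hc : c < N⁻¹) : (N : ℝ) * c < 1 := by
  have hN0 : N ≠ 0 := by rintro rfl; simp at hc
  have h : N * c < N * N⁻¹ := mul_lt_mul_of_pos_left hc (pos_iff_ne_zero.2 hN0)
  rw [mul_inv_cancel₀ hN0] at h
  exact_mod_cast h

/-- **THE BRANCH ALONG A SLICE, WITH THE SHARP LETTERS** (HSBD `hasFDerivAt_sliceBranch_of_chart`'s hypotheses verbatim): at every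
interior `w ∈ ball w₀ ρ` there is an equivalence `A = DΦ(σ w)` with `HasFDerivAt σ (A⁻¹ ∘ inl) w`,
`‖A⁻¹ ∘ inl‖ ≤ (1 − Nc)⁻¹·‖T⁻¹ ∘ inl‖` and `‖A⁻¹ ∘ inl − T⁻¹ ∘ inl‖ ≤ Nc(1 − Nc)⁻¹·‖T⁻¹ ∘ inl‖`. [folklore] -/
theorem hasFDerivAt_sliceBranch_sharp [CompleteSpace E] {Φ : E → F × H} {Φ' : E → E →L[ℝ] F × H}
    (T : E ≃L[ℝ] F × H) {δ₀ : E} {r ρ : ℝ} {N c : ℝ≥0}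
    (hN : ∀ y : F × H, ‖T.symm y‖ ≤ N * ‖y‖) (hc : c < N⁻¹)
    (hΦd : ∀ x ∈ closedBall δ₀ r, HasFDerivAt Φ (Φ' x) x)
    (hΦc : ∀ x ∈ closedBall δ₀ r, ‖Φ' x - (T : E →L[ℝ] F × H)‖ ≤ c)
    {σ : F → E} {w₀ : F} {z₀ : H}
    (hσ : ∀ w ∈ closedBall w₀ ρ, σ w ∈ closedBall δ₀ r ∧ (Φ (σ w)).1 = w ∧ (Φ (σ w)).2 = z₀)
    (hσc : ContinuousOn σ (closedBall w₀ ρ)) {w : F} (hw : w ∈ ball w₀ ρ) :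
    ∃ A : E ≃L[ℝ] F × H, (A : E →L[ℝ] F × H) = Φ' (σ w) ∧
      HasFDerivAt σ ((A.symm : F × H →L[ℝ] E).comp (ContinuousLinearMap.inl ℝ F H)) w ∧
      ‖(A.symm : F × H →L[ℝ] E).comp (ContinuousLinearMap.inl ℝ F H)‖ ≤
        (1 - (N : ℝ) * c)⁻¹ * ‖(T.symm : F × H →L[ℝ] E).comp (ContinuousLinearMap.inl ℝ F H)‖ ∧
      ‖(A.symm : F × H →L[ℝ] E).comp (ContinuousLinearMap.inl ℝ F H) -
          (T.symm : F × H →L[ℝ] E).comp (ContinuousLinearMap.inl ℝ F H)‖ ≤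
        (N : ℝ) * c * (1 - (N : ℝ) * c)⁻¹ * ‖(T.symm : F × H →L[ℝ] E).comp (ContinuousLinearMap.inl ℝ F H)‖ := by
  obtain ⟨A, hAeq, -, hd, -⟩ := hasFDerivAt_sliceBranch_of_chart T hN hc hΦd hΦc hσ hσc hw
  have hσw : σ w ∈ closedBall δ₀ r := (hσ w (ball_subset_closedBall hw)).1
  have hA : ‖(A : E →L[ℝ] F × H) - (T : E →L[ℝ] F × H)‖ ≤ c := by rw [hAeq]; exact hΦc _ hσw
  have hNc := coe_mul_lt_one_of_lt_inv hc
  exact ⟨A, hAeq, hd, opNorm_symm_comp_le_sharp T A hN hA hNc _, opNorm_symm_comp_sub_le_sharp T A hN hA hNc _⟩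

/-- **`‖σ′(w)‖ ≤ (1 − Nc)⁻¹·‖T⁻¹ ∘ inl‖`** — THE CHART CONSTANT IS THE REFERENCE SECTION's NORM through the Neumann factor
(HSBD `norm_fderiv_sliceBranch_le`'s letters verbatim; its `(N⁻¹ − c)⁻¹` replaced). [folklore] -/
theorem norm_fderiv_sliceBranch_le_sharp [CompleteSpace E] {Φ : E → F × H} {Φ' : E → E →L[ℝ] F × H}
    (T : E ≃L[ℝ] F × H) {δ₀ : E} {r ρ : ℝ} {N c : ℝ≥0}
    (hN : ∀ y : F × H, ‖T.symm y‖ ≤ N * ‖y‖) (hc : c < N⁻¹)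
    (hΦd : ∀ x ∈ closedBall δ₀ r, HasFDerivAt Φ (Φ' x) x)
    (hΦc : ∀ x ∈ closedBall δ₀ r, ‖Φ' x - (T : E →L[ℝ] F × H)‖ ≤ c)
    {σ : F → E} {w₀ : F} {z₀ : H}
    (hσ : ∀ w ∈ closedBall w₀ ρ, σ w ∈ closedBall δ₀ r ∧ (Φ (σ w)).1 = w ∧ (Φ (σ w)).2 = z₀)
    (hσc : ContinuousOn σ (closedBall w₀ ρ)) {w : F} (hw : w ∈ ball w₀ ρ) :
    DifferentiableAt ℝ σ w ∧
      ‖fderiv ℝ σ w‖ ≤ (1 - (N : ℝ) * c)⁻¹ * ‖(T.symm : F × H →L[ℝ] E).comp (ContinuousLinearMap.inl ℝ F H)‖ := by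
  obtain ⟨A, -, hd, hn, -⟩ := hasFDerivAt_sliceBranch_sharp T hN hc hΦd hΦc hσ hσc hw
  exact ⟨hd.differentiableAt, by rwa [hd.fderiv]⟩

/-- **`‖σ′(w) − T⁻¹ ∘ inl‖ ≤ Nc(1 − Nc)⁻¹·‖T⁻¹ ∘ inl‖`** — along the whole chart the branch derivative stays within RELATIVE distance
`Nc∕(1 − Nc)` of the reference section (no modulus of the Hessian needed). [folklore] -/
theorem norm_fderiv_sliceBranch_sub_le_sharp [CompleteSpace E] {Φ : E → F × H} {Φ' : E → E →L[ℝ] F × H}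
    (T : E ≃L[ℝ] F × H) {δ₀ : E} {r ρ : ℝ} {N c : ℝ≥0}
    (hN : ∀ y : F × H, ‖T.symm y‖ ≤ N * ‖y‖) (hc : c < N⁻¹)
    (hΦd : ∀ x ∈ closedBall δ₀ r, HasFDerivAt Φ (Φ' x) x)
    (hΦc : ∀ x ∈ closedBall δ₀ r, ‖Φ' x - (T : E →L[ℝ] F × H)‖ ≤ c)
    {σ : F → E} {w₀ : F} {z₀ : H}
    (hσ : ∀ w ∈ closedBall w₀ ρ, σ w ∈ closedBall δ₀ r ∧ (Φ (σ w)).1 = w ∧ (Φ (σ w)).2 = z₀)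
    (hσc : ContinuousOn σ (closedBall w₀ ρ)) {w : F} (hw : w ∈ ball w₀ ρ) :
    ‖fderiv ℝ σ w - (T.symm : F × H →L[ℝ] E).comp (ContinuousLinearMap.inl ℝ F H)‖ ≤
      (N : ℝ) * c * (1 - (N : ℝ) * c)⁻¹ * ‖(T.symm : F × H →L[ℝ] E).comp (ContinuousLinearMap.inl ℝ F H)‖ := by
  obtain ⟨A, -, hd, -, hs⟩ := hasFDerivAt_sliceBranch_sharp T hN hc hΦd hΦc hσ hσc hw
  rwa [hd.fderiv]

end Chart

/-! ## §3. The chart constant in HSUB's real letters: `K₁♯ = (1 − Nc)⁻¹τ₀ ≤ K₁ = (N⁻¹ − c)⁻¹`, and F686's route does not apply -/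

section RealLetters

/-- **`K₁♯ ≤ K₁`**: `τ₀ ≤ N`, `Nc < 1`, `N > 0` ⟹ `(1 − Nc)⁻¹τ₀ ≤ (N⁻¹ − c)⁻¹` (`N(1 − Nc)⁻¹ = (N⁻¹ − c)⁻¹`). [folklore] -/
theorem sharpChart_le_crudeChart {N c τ₀ : ℝ} (hN : 0 < N) (hNc : N * c < 1) (hτ : τ₀ ≤ N) :
    (1 - N * c)⁻¹ * τ₀ ≤ (N⁻¹ - c)⁻¹ := by
  have hpos : 0 < 1 - N * c := sub_pos.2 hNc
  have h1 : N⁻¹ - c = (1 - N * c) / N := by field_simp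
  calc (1 - N * c)⁻¹ * τ₀ ≤ (1 - N * c)⁻¹ * N := mul_le_mul_of_nonneg_left hτ (inv_nonneg.2 hpos.le)
    _ = (N⁻¹ - c)⁻¹ := by rw [h1, inv_div, div_eq_inv_mul]

/-- **`Θ♯ ≤ Θ`**: the Hessian-size ratio of HSUB with the sharp chart constant is never above the crude one. [folklore] -/
theorem theta_sharp_le_theta {N c τ₀ d γ : ℝ} (hN : 0 < N) (hNc : N * c < 1) (hτ0 : 0 ≤ τ₀) (hτ : τ₀ ≤ N)
    (hγ : 0 < γ) : ((1 - N * c)⁻¹ * τ₀) ^ 2 * d ^ 2 / γ ≤ ((N⁻¹ - c)⁻¹) ^ 2 * d ^ 2 / γ := by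
  have h := sharpChart_le_crudeChart hN hNc hτ
  have h0 : 0 ≤ (1 - N * c)⁻¹ * τ₀ := mul_nonneg (inv_nonneg.2 (sub_pos.2 hNc).le) hτ0
  have h2 : ((1 - N * c)⁻¹ * τ₀) ^ 2 ≤ ((N⁻¹ - c)⁻¹) ^ 2 := pow_le_pow_left₀ h0 h 2
  exact div_le_div_of_nonneg_right (mul_le_mul_of_nonneg_right h2 (sq_nonneg d)) hγ.le

/-- **THE SHARP CHART CONSTANT THROUGH A TEST SECTION** (THEC §1c's shape `τ₀ ≤ s + √(C∕m)` fed in, `s = ‖S‖`):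
`K₁♯ = (1 − Nc)⁻¹τ₀ ≤ (1 − Nc)⁻¹(s + √(C∕m))`. [folklore] -/
theorem sharpChart_le_of_testSection {N c τ₀ s C m : ℝ} (hNc : N * c < 1) (hτ : τ₀ ≤ s + Real.sqrt (C / m)) :
    (1 - N * c)⁻¹ * τ₀ ≤ (1 - N * c)⁻¹ * (s + Real.sqrt (C / m)) :=
  mul_le_mul_of_nonneg_left hτ (inv_nonneg.2 (sub_pos.2 hNc).le)

/-- Toy (F686's route does not apply to `K₁♯`): `N = 10`, `c = 0`, `τ₀ = 1`: `K₁ = (10⁻¹ − 0)⁻¹ = 10 ≥ N` while `K₁♯ = (1 − 0)⁻¹·1 = 1 < N`. -/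
example : ((10 : ℝ)⁻¹ - 0)⁻¹ = 10 ∧ (1 - (10 : ℝ) * 0)⁻¹ * 1 = 1 ∧ (1 - (10 : ℝ) * 0)⁻¹ * 1 < 10 := by norm_num

/-- Toy (with a small modulus product `Nc = 1∕2`): `K₁♯ = 2τ₀`, against `K₁ = 2N`. -/
example (N τ₀ : ℝ) (hN : N ≠ 0) : (1 - N * (1 / (2 * N)))⁻¹ * τ₀ = 2 * τ₀ ∧ (N⁻¹ - 1 / (2 * N))⁻¹ = 2 * N := by
  constructor
  · field_simp; ring
  · field_simp; ring

end RealLetters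

/-! ## §4. Toy for §1 on `ℝ` -/

/-- Toy: `E = G = ℝ`, `T = A = 1` (`c = 0`, `N = 1`): `‖A⁻¹z‖ ≤ (1 − 1·0)⁻¹‖T⁻¹z‖`. -/
example (z : ℝ) : ‖(ContinuousLinearEquiv.refl ℝ ℝ).symm z‖ ≤ (1 - ((1 : ℝ≥0) : ℝ) * ((0 : ℝ≥0) : ℝ))⁻¹ *
    ‖(ContinuousLinearEquiv.refl ℝ ℝ).symm z‖ :=
  norm_symm_le_sharp (ContinuousLinearEquiv.refl ℝ ℝ) (ContinuousLinearEquiv.refl ℝ ℝ) (N := 1) (c := 0)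
    (fun y => by simp) (by simp) (by simp) z

end Summit.QuantumFields.BalabanUV.T4Continuum.NE7b.HardStepBranchDerivSharp
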